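import Literature.Geometry.Lorentzian.TeukolskyRadialFluxInfinity
import HarnessLib

/-!
# Limits at infinity of the normalised scalar infinity solution `R_{𝓘⁺}`:
# `|u_𝓘| → 1` and `|u_𝓘′| → |ω|` as `r → ∞` (Teixeira da Costa 2020, Def. 2.3)

Companion of `TeukolskyRadialFluxInfinity.lean` and the `r → ∞` counterpart of
`TeukolskyHorizonNormalisedLimits.lean` (R. Teixeira da Costa, Commun. Math. Phys. 378 (2020)
705–781 = arXiv:1910.02854 [Costa2019]). For spin `s = 0`, a radial function `R` normalised at
`𝓘⁺` as in Def. 2.3 (`Kerr.IsNormalisedInfinitySolution M 0 ω R`: coefficients `c_k` with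
`|c₀| = 1` and, for every `N ≥ 1`, `R(r) = Φ(r) Σ_{k ≤ N} c_k r^{−k−1} + O(r^{−N−2})`,
`Φ(r) = e^{iωr + 2iMω log r}`, `|Φ| = 1`) satisfies, in the variable `u = (r² + a²)^{1/2} R` with
the tortoise derivative `u′ = du/dr* = (Δ/(r² + a²))·du/dr` (`Δ = r² − 2Mr + a²`), the two
boundary data at `r* = +∞` (DRSR: `u ∼ e^{iωr*}`, `u′ − iωu = 0` at `r = ∞`):

* `Costa2019.tendsto_norm_infinitySolution` — `(r² + a²)^{1/2} |R(r)| → 1` as `r → ∞`: from the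
  `N = 1` expansion `r·conj Φ(r)·R(r) → c₀`, so `r|R(r)| → |c₀| = 1`, and `(r² + a²)^{1/2}/r → 1`.
  Only the normalisation is used (no ODE, no restriction on `M`, `a`, `ω`), so none is assumed;
* `Costa2019.tendsto_norm_deriv_infinitySolution` — for `0 < M`, `|a| < M`, `ω ≠ 0` and `R` a
  classical solution of the scalar radial ODE: `(Δ/(r² + a²))·|d/dr[(r² + a²)^{1/2} R](r)| → |ω|`
  as `r → ∞`. Here `d/dr[S R] = (r/S) R + S R′` (`S = (r² + a²)^{1/2}`), and after multiplication
  by the unimodular `conj Φ`, `(r/S) R + S R′ = Φ·[S⁻¹·u + (S/r)·v]` with `u = r conj Φ R → c₀`,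
  `v = r conj Φ R′ → iω c₀` (the derivative asymptotics `R′ − P_N′ = O(r^{(−N−2+K)/2})` of
  `Costa2019.outgoing_remainder_bounds_allSpin`, used with an order `N > K` — this is where the ODE
  enters), `S⁻¹ → 0`, `S/r → 1`, `Δ/(r² + a²) → 1`; the limit is `|iω c₀| = |ω|`.

These are the `𝓘⁺` boundary values entering every envelope / energy bound for `u_𝓘`
(`|u_𝓘|² → 1`, `|u_𝓘′|² → ω²`); the flux `Δ·Im(R̄ R′) ≡ ω` extracted from the same data is
`Costa2019.radialFlux_eq_of_normalisedInfinity`. Not here: the `s ≠ 0` case, the Sonin-energy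
corollaries (they need the `r*`-Schrödinger form of the ODE). Everything is proved; theorems only.

## References
* R. Teixeira da Costa, CMP 378 (2020) 705–781 = arXiv:1910.02854: Def. 2.3 (normalised
  solutions `R_{𝓗⁺}`, `R_{𝓘⁺}`, footnote: the expansion at `𝓘⁺`), Proposition 2.20. [Costa2019]
* M. Dafermos, I. Rodnianski, Y. Shlapentokh-Rothman, *Decay for solutions of the wave equation on
  Kerr exterior spacetimes III*, arXiv:1402.7034: §5.3 (boundary behaviour `u′ − iωu = 0` at
  `r = ∞`). [DafermosRodnianskiShlapentokhrothman2014]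
-/

noncomputable section

open Complex Set Filter Topology
open scoped ComplexConjugate

namespace Literature.Geometry.Lorentzian.Kerr

namespace Costa2019

/-! ### Elementary limits in the weight `S = (r² + a²)^{1/2}` -/

/-- `‖t · conj Φ(t) · z‖ = t ‖z‖` for `t > 0` (`Φ = outgoingPhase M ω`, `|Φ| = 1`). [folklore] -/
private theorem norm_ofReal_mul_conj_phase_mul (M ω : ℝ) {t : ℝ} (ht : 0 < t) (z : ℂ) :
    ‖(t : ℂ) * conj (outgoingPhase M ω t) * z‖ = t * ‖z‖ := by
  rw [norm_mul, norm_mul, Complex.norm_conj, norm_outgoingPhase, mul_one, Complex.norm_real,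
    Real.norm_eq_abs, abs_of_pos ht]

/-- `(t² + a²)^{1/2} / t → 1` as `t → ∞`. [folklore] -/
private theorem tendsto_sqrt_sq_add_sq_div (a : ℝ) :
    Tendsto (fun t : ℝ => Real.sqrt (t ^ 2 + a ^ 2) / t) atTop (𝓝 1) := by
  have h := tendsto_inv_atTop_zero (𝕜 := ℝ)
  have h2 : Tendsto (fun t : ℝ => Real.sqrt (1 + a ^ 2 * (t⁻¹ * t⁻¹))) atTop
      (𝓝 (Real.sqrt (1 + a ^ 2 * (0 * 0)))) :=
    (tendsto_const_nhds.add ((h.mul h).const_mul _)).sqrt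
  rw [mul_zero, mul_zero, add_zero, Real.sqrt_one] at h2
  refine h2.congr' ?_
  filter_upwards [eventually_gt_atTop 0] with t ht
  have e : 1 + a ^ 2 * (t⁻¹ * t⁻¹) = (t ^ 2 + a ^ 2) / t ^ 2 := by
    field_simp
  rw [e, Real.sqrt_div' _ (sq_nonneg t), Real.sqrt_sq ht.le]

/-- `(t² + a²)^{1/2} → ∞` as `t → ∞`. [folklore] -/
private theorem tendsto_sqrt_sq_add_sq_atTop (a : ℝ) :
    Tendsto (fun t : ℝ => Real.sqrt (t ^ 2 + a ^ 2)) atTop atTop :=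
  tendsto_atTop_mono (fun t => (le_abs_self t).trans
    (Real.abs_le_sqrt (by nlinarith [sq_nonneg a]))) tendsto_id

/-- `Δ(t)/(t² + a²) → 1` as `t → ∞`. [folklore] -/
private theorem tendsto_delta_div_sq_add_sq (M a : ℝ) :
    Tendsto (fun t : ℝ => delta M a t / (t ^ 2 + a ^ 2)) atTop (𝓝 1) := by
  have h := tendsto_inv_atTop_zero (𝕜 := ℝ)
  have h2 : Tendsto (fun t : ℝ => (1 - 2 * M * t⁻¹ + a ^ 2 * (t⁻¹ * t⁻¹)) /
      (1 + a ^ 2 * (t⁻¹ * t⁻¹))) atTop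
      (𝓝 ((1 - 2 * M * 0 + a ^ 2 * (0 * 0)) / (1 + a ^ 2 * (0 * 0)))) :=
    ((tendsto_const_nhds.sub (h.const_mul _)).add ((h.mul h).const_mul _)).div
      (tendsto_const_nhds.add ((h.mul h).const_mul _)) (by norm_num)
  rw [show (1 - 2 * M * 0 + a ^ 2 * (0 * 0)) / (1 + a ^ 2 * (0 * 0)) = (1 : ℝ) by norm_num] at h2
  refine h2.congr' ?_
  filter_upwards [eventually_gt_atTop 0] with t ht
  have ht2 : 0 < t ^ 2 + a ^ 2 := by positivity
  rw [delta, div_eq_div_iff (by positivity) ht2.ne']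
  field_simp

/-- `d/ds (s² + a²)^{1/2} = s/(s² + a²)^{1/2}` at a point `y` with `y² + a² > 0`. [folklore] -/
private theorem hasDerivAt_sqrt_sq_add_sq_infty {a y : ℝ} (hy : 0 < y ^ 2 + a ^ 2) :
    HasDerivAt (fun s : ℝ => Real.sqrt (s ^ 2 + a ^ 2)) (y / Real.sqrt (y ^ 2 + a ^ 2)) y := by
  have h1 : HasDerivAt (fun s : ℝ => s ^ 2 + a ^ 2) (2 * y) y := by
    simpa using (hasDerivAt_pow 2 y).add_const (a ^ 2)
  refine (h1.sqrt hy.ne').congr_deriv ?_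
  rw [mul_div_mul_left _ _ (two_ne_zero' ℝ)]

/-! ### `u = r conj Φ R → c₀` and `v = r conj Φ R′ → iω c₀` -/

/-- `s = 0`: if `|R − P_N| ≤ C t^{p}` for `t ≥ X` with `p < −1` (`P_N = outgoingP M 0 ω c N`),
then `t · conj Φ(t) · R(t) → c₀` as `t → ∞` (`t·π_N(t) → c₀`, `Φ conj Φ = 1`).
[cite: Costa2019, Definition 2.3] -/
private theorem tendsto_mul_conj_phase_mul {M ω : ℝ} {R : ℝ → ℂ} {c : ℕ → ℂ} {N : ℕ}
    {C X p : ℝ} (hp : p < -1)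
    (hB : ∀ t, X ≤ t → ‖R t - outgoingP M 0 ω c N t‖ ≤ C * t ^ p) :
    Tendsto (fun t : ℝ => (t : ℂ) * conj (outgoingPhase M ω t) * R t) atTop (𝓝 (c 0)) := by
  have hΦ : ∀ t, outgoingPhase M ω t * conj (outgoingPhase M ω t) = 1 :=
    outgoingPhase_mul_conj M ω
  have h1 : Tendsto (fun t : ℝ => (t : ℂ) * conj (outgoingPhase M ω t) *
      (R t - outgoingP M 0 ω c N t)) atTop (𝓝 0) := by
    have hg := (tendsto_mul_rpow_of_lt_neg_one hp).const_mul C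
    rw [mul_zero] at hg
    refine squeeze_zero_norm' ?_ hg
    filter_upwards [eventually_ge_atTop X, eventually_gt_atTop 0] with t ht ht0
    rw [norm_ofReal_mul_conj_phase_mul M ω ht0]
    calc t * ‖R t - outgoingP M 0 ω c N t‖ ≤ t * (C * t ^ p) :=
          mul_le_mul_of_nonneg_left (hB t ht) ht0.le
      _ = C * (t * t ^ p) := by ring
  have h := h1.add (tendsto_mul_outgoingSum_zero c N)
  rw [zero_add] at h
  refine h.congr fun t => ?_
  simp only [outgoingP]
  linear_combination (-(t : ℂ) * outgoingSum 0 c N t) * hΦ t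

/-- `s = 0`: if `|R′ − P_N′| ≤ C t^{q}` for `t ≥ X` with `q < −1` (`P_N′ = outgoingPDeriv M 0 ω c N`),
then `t · conj Φ(t) · R′(t) → iω c₀` as `t → ∞` (`t·π_N → c₀`, `t·π_N′ → 0`, `2iMω/t → 0`).
[cite: Costa2019, Definition 2.3] -/
private theorem tendsto_mul_conj_phase_mul_deriv {M ω : ℝ} {R : ℝ → ℂ} {c : ℕ → ℂ} {N : ℕ}
    {C X q : ℝ} (hq : q < -1)
    (hB : ∀ t, X ≤ t → ‖deriv R t - outgoingPDeriv M 0 ω c N t‖ ≤ C * t ^ q) :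
    Tendsto (fun t : ℝ => (t : ℂ) * conj (outgoingPhase M ω t) * deriv R t) atTop
      (𝓝 (I * ω * c 0)) := by
  have hΦ : ∀ t, outgoingPhase M ω t * conj (outgoingPhase M ω t) = 1 :=
    outgoingPhase_mul_conj M ω
  have h1 : Tendsto (fun t : ℝ => (t : ℂ) * conj (outgoingPhase M ω t) *
      (deriv R t - outgoingPDeriv M 0 ω c N t)) atTop (𝓝 0) := by
    have hg := (tendsto_mul_rpow_of_lt_neg_one hq).const_mul C
    rw [mul_zero] at hg
    refine squeeze_zero_norm' ?_ hg
    filter_upwards [eventually_ge_atTop X, eventually_gt_atTop 0] with t ht ht0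
    rw [norm_ofReal_mul_conj_phase_mul M ω ht0]
    calc t * ‖deriv R t - outgoingPDeriv M 0 ω c N t‖ ≤ t * (C * t ^ q) :=
          mul_le_mul_of_nonneg_left (hB t ht) ht0.le
      _ = C * (t * t ^ q) := by ring
  have hinv : Tendsto (fun t : ℝ => (t : ℂ)⁻¹) atTop (𝓝 0) := by
    have := (tendsto_inv_atTop_zero (𝕜 := ℝ)).ofReal
    simpa using this
  have h2 : Tendsto (fun t : ℝ => (I * ω + 2 * I * M * ω * (t : ℂ)⁻¹) *
      ((t : ℂ) * outgoingSum 0 c N t) + (t : ℂ) * outgoingSumDeriv 0 c N t) atTop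
      (𝓝 ((I * ω + 2 * I * M * ω * 0) * c 0 + 0)) :=
    ((tendsto_const_nhds.add (hinv.const_mul _)).mul (tendsto_mul_outgoingSum_zero c N)).add
      (tendsto_mul_outgoingSumDeriv_zero c N)
  rw [mul_zero, add_zero, add_zero] at h2
  have h := h1.add h2
  rw [zero_add] at h
  refine h.congr fun t => ?_
  simp only [outgoingPDeriv]
  linear_combination (-(t : ℂ) * ((I * ω + 2 * I * M * ω * (t : ℂ)⁻¹) * outgoingSum 0 c N t +
    outgoingSumDeriv 0 c N t)) * hΦ t

/-! ### `|u_𝓘| → 1` -/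

/-- **`(r² + a²)^{1/2}|R_{𝓘⁺}(r)| → 1` as `r → ∞`** for a radial function normalised at `𝓘⁺` as
in Def. 2.3 (`s = 0`): the `N = 1` expansion gives `r·conj Φ(r)·R(r) → c₀` with `|Φ| = 1`,
`|c₀| = 1`, so `r|R(r)| → 1`, and `(r² + a²)^{1/2}/r → 1`. Only the normalised expansion is
used: no hypothesis on `M`, `a`, `ω` and no ODE is needed, so none is assumed.
[cite: Costa2019, Definition 2.3] -/
theorem tendsto_norm_infinitySolution {M a ω : ℝ} {R : ℝ → ℂ}
    (hn : IsNormalisedInfinitySolution M 0 ω R) :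
    Tendsto (fun r ↦ Real.sqrt (r ^ 2 + a ^ 2) * ‖R r‖) atTop (𝓝 1) := by
  obtain ⟨c, hc0, hc⟩ := hn
  obtain ⟨C, r₀, hC⟩ := hc 1 le_rfl
  have hu : Tendsto (fun t : ℝ => (t : ℂ) * conj (outgoingPhase M ω t) * R t) atTop (𝓝 (c 0)) :=
    tendsto_mul_conj_phase_mul (N := 1) (C := C) (X := r₀) (by norm_num) hC
  have h := (tendsto_sqrt_sq_add_sq_div a).mul hu.norm
  rw [hc0, one_mul] at h
  refine h.congr' ?_
  filter_upwards [eventually_gt_atTop 0] with t ht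
  rw [norm_ofReal_mul_conj_phase_mul M ω ht]
  field_simp

/-! ### `|u_𝓘′| → |ω|` -/

/-- **`(Δ/(r² + a²))·|d/dr[(r² + a²)^{1/2} R_{𝓘⁺}](r)| → |ω|` as `r → ∞`** (`s = 0`, `0 < M`,
`|a| < M`, `ω ≠ 0`), i.e. `|u_𝓘′| → |ω|` at `r* = +∞` for `u = (r² + a²)^{1/2} R`,
`′ = d/dr* = (Δ/(r² + a²)) d/dr`, `R` a classical solution of the scalar radial ODE normalised at
`𝓘⁺` as in Def. 2.3: with `S = (r² + a²)^{1/2}`, `d/dr[S R] = (r/S) R + S R′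
= Φ·[S⁻¹·(r conj Φ R) + (S/r)·(r conj Φ R′)]`, where `r conj Φ R → c₀`, `r conj Φ R′ → iω c₀`
(derivative asymptotics of the outgoing expansion, `Costa2019.outgoing_remainder_bounds_allSpin`,
at an order `N > K`), `S⁻¹ → 0`, `S/r → 1`, `Δ/(r² + a²) → 1`, `|Φ| = 1`, `|c₀| = 1`.
[cite: Costa2019, Definition 2.3] -/
theorem tendsto_norm_deriv_infinitySolution {M a ω m lam : ℝ} (hM : 0 < M) (ha : |a| < M)
    (hω : ω ≠ 0) {R : ℝ → ℂ} (hR : IsRadialTeukolskySolution M a 0 ω m lam R)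
    (hn : IsNormalisedInfinitySolution M 0 ω R) :
    Tendsto (fun r ↦ delta M a r / (r ^ 2 + a ^ 2) *
        ‖deriv (fun s : ℝ ↦ ((Real.sqrt (s ^ 2 + a ^ 2) : ℝ) : ℂ) * R s) r‖) atTop (𝓝 |ω|) := by
  obtain ⟨c, hc0, hc⟩ := hn
  obtain ⟨hd1, -, -, -⟩ := deriv_facts_of_isRadialTeukolskySolution ha.le hR
  obtain ⟨K, -, hK⟩ := outgoing_remainder_bounds_allSpin hM ha hω hR (c := c) hc
  -- an expansion order `N > K`, so that both remainders are `o(r⁻¹)`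
  set N : ℕ := ⌈K⌉₊ + 1 with hN
  have hKN : K < N := by
    rw [hN]; push_cast; linarith [Nat.le_ceil K]
  have hN1 : 1 ≤ N := by rw [hN]; exact Nat.le_add_left 1 _
  obtain ⟨X, C, -, -, hB⟩ := hK N hN1 (by norm_num)
  have hN1' : (1 : ℝ) ≤ N := by exact_mod_cast hN1
  have hp : (-(2 * (0 : ℝ)) - (N : ℝ) - 2) < -1 := by linarith
  have hq : (-(2 * (0 : ℝ)) - (N : ℝ) - 2 + K) / 2 < -1 := by
    rw [div_lt_iff₀ two_pos]; linarith
  -- `u = t conj Φ R → c₀`, `v = t conj Φ R′ → iω c₀`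
  have hu : Tendsto (fun t : ℝ => (t : ℂ) * conj (outgoingPhase M ω t) * R t) atTop (𝓝 (c 0)) :=
    tendsto_mul_conj_phase_mul hp fun t ht => (hB t ht).1
  have hv : Tendsto (fun t : ℝ => (t : ℂ) * conj (outgoingPhase M ω t) * deriv R t) atTop
      (𝓝 (I * ω * c 0)) :=
    tendsto_mul_conj_phase_mul_deriv hq fun t ht => (hB t ht).2
  -- the weights `S⁻¹ → 0`, `S/t → 1`
  have hinvS : Tendsto (fun t : ℝ => (((Real.sqrt (t ^ 2 + a ^ 2))⁻¹ : ℝ) : ℂ)) atTop (𝓝 0) := by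
    have h := (tendsto_inv_atTop_zero.comp (tendsto_sqrt_sq_add_sq_atTop a)).ofReal
    rw [Complex.ofReal_zero] at h
    exact h
  have hSt : Tendsto (fun t : ℝ => ((Real.sqrt (t ^ 2 + a ^ 2) / t : ℝ) : ℂ)) atTop (𝓝 1) := by
    have h := (tendsto_sqrt_sq_add_sq_div a).ofReal
    rw [Complex.ofReal_one] at h
    exact h
  -- the comparison function and its limit `1 · |0 · c₀ + 1 · iω c₀| = |ω|`
  have hval : (1 : ℝ) * ‖(0 : ℂ) * c 0 + 1 * (I * ω * c 0)‖ = |ω| := by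
    rw [zero_mul, zero_add, one_mul, one_mul, norm_mul, norm_mul, Complex.norm_I, one_mul,
      Complex.norm_real, Real.norm_eq_abs, hc0, mul_one]
  have hlim : Tendsto (fun t : ℝ => delta M a t / (t ^ 2 + a ^ 2) *
      ‖(((Real.sqrt (t ^ 2 + a ^ 2))⁻¹ : ℝ) : ℂ) * ((t : ℂ) * conj (outgoingPhase M ω t) * R t) +
        ((Real.sqrt (t ^ 2 + a ^ 2) / t : ℝ) : ℂ) *
          ((t : ℂ) * conj (outgoingPhase M ω t) * deriv R t)‖) atTop (𝓝 |ω|) := by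
    have h := (tendsto_delta_div_sq_add_sq M a).mul (((hinvS.mul hu).add (hSt.mul hv)).norm)
    rw [hval] at h
    exact h
  -- for `t > r₊`, `t > 0` the target function IS the comparison function
  refine hlim.congr' ?_
  filter_upwards [eventually_gt_atTop (rPlus M a), eventually_gt_atTop 0] with t ht ht0
  have ht2 : 0 < t ^ 2 + a ^ 2 := by positivity
  have hS0 : 0 < Real.sqrt (t ^ 2 + a ^ 2) := Real.sqrt_pos.2 ht2
  have hD : HasDerivAt (fun s : ℝ => ((Real.sqrt (s ^ 2 + a ^ 2) : ℝ) : ℂ) * R s)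
      (((t / Real.sqrt (t ^ 2 + a ^ 2) : ℝ) : ℂ) * R t +
        ((Real.sqrt (t ^ 2 + a ^ 2) : ℝ) : ℂ) * deriv R t) t :=
    (hasDerivAt_sqrt_sq_add_sq_infty ht2).ofReal_comp.fun_mul (hd1 t ht)
  rw [hD.deriv]
  congr 1
  have hT : (t : ℂ) ≠ 0 := by exact_mod_cast ht0.ne'
  have hSc : ((Real.sqrt (t ^ 2 + a ^ 2) : ℝ) : ℂ) ≠ 0 := by exact_mod_cast hS0.ne'
  have e : (((Real.sqrt (t ^ 2 + a ^ 2))⁻¹ : ℝ) : ℂ) * ((t : ℂ) * conj (outgoingPhase M ω t) * R t) +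
      ((Real.sqrt (t ^ 2 + a ^ 2) / t : ℝ) : ℂ) *
        ((t : ℂ) * conj (outgoingPhase M ω t) * deriv R t) =
      conj (outgoingPhase M ω t) * ((((t / Real.sqrt (t ^ 2 + a ^ 2) : ℝ)) : ℂ) * R t +
        ((Real.sqrt (t ^ 2 + a ^ 2) : ℝ) : ℂ) * deriv R t) := by
    push_cast
    field_simp
  rw [e, norm_mul, Complex.norm_conj, norm_outgoingPhase, one_mul]

end Costa2019

end Literature.Geometry.Lorentzian.Kerr

end
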